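import Mathlib
import Summits.Ventures.PercRepro.TriangleCapLineExplicit
import Summits.Ventures.PercRepro.TriangleCapCubicSix

/-!
# PercRepro — THE LINE `k − r = 6` FOR `k ≥ 10`: EXACTLY TWO SHAPES — `K_{3,k−3}` minus a star at a small-side
vertex, and the prism with `k − 6` vertices hung on one non-adjacent pair (p3, gen 42; part 177)

Parts 174–176 describe the extremal graphs of the line as the star-shaped graphs and the hang family on a
`K_{3,3}` or prism core.  For `k ≥ 10` the two descriptions merge: a star of `k − 6 ≥ 4` missing pairs cannot
sit at a vertex of the large side (it has only three cross pairs), so the star sits at a small-side vertex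
`v`, whose three remaining neighbours together with the small side form a `K_{3,3}` core on which the other
`k − 6` vertices hang on the two small-side vertices other than `v` (`hangFamily_of_star`).  Hence
`line_eq_iff_ten`: for `k ≥ 10` a `K₄⁻`-free graph with `2k − 3` edges is extremal iff it is a hang family
graph; and, the pair being non-adjacent as soon as two vertices hang on it (`hangOn_not_adj`, `k ≥ 8`:
two hung vertices on an edge make a `K₄⁻`), `line_eq_iff_ten_explicit`: extremal iff a cubic six-core that
is `K_{3,3}` or the prism with every other vertex hung on one NON-ADJACENT pair of the core.  (In `K_{3,3}` a
non-adjacent pair lies on one side: the graph is `K_{3,k−3}` minus a `(k−6)`-star; in the prism it is a pair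
`aᵢ bⱼ`, `i ≠ j`: the prism-hanging family.)  The same two shapes with the star-shaped graphs added is
`line_eq_iff_explicit'` for every `k ≥ 7`.  Axioms: standard.
-/

namespace PercRepro

namespace TriangleCap

namespace C047

open Finset

variable {V : Type*} [Fintype V] [DecidableEq V]

/-- **THE PAIR IS NON-ADJACENT FROM `k = 8` ON:** two vertices hung on an edge `x y` form a `K₄⁻` with it. -/
theorem hangOn_not_adj (D : SimpleGraph V) [DecidableRel D.Adj] (hK : K4mFree D) (hk : 8 ≤ Fintype.card V)
    {C : Finset V} {x y : V} (h : HangOn D C x y) : ¬ D.Adj x y := by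
  intro hxy
  obtain ⟨hC, -, -, -, -, hout⟩ := id h
  have hcompl : 1 < Cᶜ.card := by
    rw [card_compl, hC]
    omega
  obtain ⟨z₁, hz₁, z₂, hz₂, hne⟩ := one_lt_card.mp hcompl
  rw [mem_compl] at hz₁ hz₂
  have h₁x : D.Adj z₁ x := (hout z₁ hz₁ x).mpr (Or.inl rfl)
  have h₁y : D.Adj z₁ y := (hout z₁ hz₁ y).mpr (Or.inr rfl)
  have h₂x : D.Adj z₂ x := (hout z₂ hz₂ x).mpr (Or.inl rfl)
  have h₂y : D.Adj z₂ y := (hout z₂ hz₂ y).mpr (Or.inr rfl)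
  exact not_adj_both D hK hxy (D.adj_symm h₁x) (D.adj_symm h₁y) hne (D.adj_symm h₂x) (D.adj_symm h₂y)

/-- **A STAR-SHAPED GRAPH OF THE LINE WITH `k ≥ 10` IS A HANG FAMILY GRAPH:** the star of `k − 6 ≥ 4` missing
pairs sits at a small-side vertex `v` of degree `3`; the core is the small side with the three neighbours
of `v`, the pair is the small side minus `v`. -/
theorem hangFamily_of_star (D : SimpleGraph V) [DecidableRel D.Adj] (hk : 10 ≤ Fintype.card V)
    (hm : D.edgeFinset.card + 3 = 2 * Fintype.card V) {A : Finset V} {v : V} (hA : A.card = 3)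
    (hsub : BipSub D A) (hv : MissingStar D A v) : HangFamily D := by
  have hr : D.edgeFinset.card + (Fintype.card V - 6) = 3 * (Fintype.card V - 3) := by omega
  have hM := card_edges_missingGraph D A hsub 3 (Fintype.card V - 6) hA hr
  have hsumM : ∑ a ∈ A, deg (missingGraph D A) a = Fintype.card V - 6 :=
    (sum_deg_part_eq_card_edges (missingGraph D A) A (bipSub_missingGraph D A)).trans hM
  -- the missing neighbours of a vertex `a ∈ A`
  have hMnb : ∀ a ∈ A, ∀ w, (missingGraph D A).Adj a w → w ∉ A ∧ (a = v ∨ w = v) := by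
    intro a ha w hw
    rw [missingGraph_adj] at hw
    exact ⟨hw.1.mp ha, hv a w ha (hw.1.mp ha) hw.2⟩
  -- the star sits on the small side
  have hvA : v ∈ A := by
    by_contra hvA
    have hle : ∀ a ∈ A, deg (missingGraph D A) a ≤ 1 := by
      intro a ha
      unfold deg
      have : univ.filter (fun w => (missingGraph D A).Adj a w) ⊆ {v} := by
        intro w hw
        rw [mem_filter] at hw
        rw [mem_singleton]
        rcases (hMnb a ha w hw.2).2 with h | h
        · exact absurd (h ▸ ha) hvA
        · exact h
      exact (card_le_card this).trans (by simp)
    have := sum_le_sum hle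
    rw [hsumM, sum_const, hA, smul_eq_mul] at this
    omega
  -- only `v` has missing pairs, and it has `k − 6` of them: `deg D v = 3`
  have hM0 : ∀ a ∈ A, a ≠ v → deg (missingGraph D A) a = 0 := by
    intro a ha hav
    unfold deg
    rw [card_eq_zero, filter_eq_empty_iff]
    intro w _ hw
    rcases hMnb a ha w hw with ⟨hwA, h | h⟩
    · exact hav h
    · exact hwA (h ▸ hvA)
  have hMv : deg (missingGraph D A) v = Fintype.card V - 6 := by
    rw [← hsumM, sum_eq_single v (fun a ha hav => hM0 a ha hav) (fun h => absurd hvA h)]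
  have hdv : deg D v = 3 := by
    have := deg_add_deg_missingGraph D A hsub v
    rw [if_pos hvA, hA, hMv] at this
    omega
  -- the three neighbours of `v`, all off `A`
  set N := univ.filter (fun w => D.Adj v w) with hN
  have hNcard : N.card = 3 := hdv
  have hNA : ∀ w ∈ N, w ∉ A := by
    intro w hw
    rw [hN, mem_filter] at hw
    exact (hsub v w hw.2).mp hvA
  have hdisj : Disjoint A N := by
    rw [disjoint_left]
    intro w hwA hwN
    exact hNA w hwN hwA
  -- the pair: the small side minus `v`
  have hA2 : (A.erase v).card = 2 := by
    rw [card_erase_of_mem hvA, hA]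
  obtain ⟨x, y, hxy, hAxy⟩ := card_eq_two.mp hA2
  have hmemxy : ∀ w, w ∈ A.erase v ↔ (w = x ∨ w = y) := by
    intro w
    rw [hAxy]
    simp only [mem_insert, mem_singleton]
  have hx : x ∈ A.erase v := (hmemxy x).mpr (Or.inl rfl)
  have hy : y ∈ A.erase v := (hmemxy y).mpr (Or.inr rfl)
  rw [mem_erase] at hx hy
  -- every vertex of `A` other than `v` is adjacent to everything off `A`
  have hfull : ∀ a ∈ A, a ≠ v → ∀ w, w ∉ A → D.Adj a w := by
    intro a ha hav w hw
    by_contra hnot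
    rcases hv a w ha hw hnot with h | h
    · exact hav h
    · exact hw (h ▸ hvA)
  refine ⟨A ∪ N, x, y, ?_, mem_union_left N hx.2, mem_union_left N hy.2, hxy, ?_, ?_⟩
  · rw [card_union_of_disjoint hdisj, hA, hNcard]
  · intro c hc
    unfold degIn
    rcases mem_union.mp hc with hcA | hcN
    · -- a vertex of `A`: its neighbours in the core are exactly `N`
      have : (A ∪ N).filter (fun w => D.Adj c w) = N := by
        ext w
        rw [mem_filter, mem_union]
        constructor
        · rintro ⟨hw | hw, hcw⟩
          · exact absurd hw ((hsub c w hcw).mp hcA)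
          · exact hw
        · intro hw
          refine ⟨Or.inr hw, ?_⟩
          by_cases hcv : c = v
          · rw [hcv]
            rw [hN, mem_filter] at hw
            exact hw.2
          · exact hfull c hcA hcv w (hNA w hw)
      rw [this, hNcard]
    · -- a vertex of `N`: its neighbours in the core are exactly `A`
      have hcA : c ∉ A := hNA c hcN
      have : (A ∪ N).filter (fun w => D.Adj c w) = A := by
        ext w
        rw [mem_filter, mem_union]
        constructor
        · rintro ⟨hw | hw, hcw⟩
          · exact hw
          · have := hsub c w hcw
            exact absurd hw (fun h => hcA (this.mpr (hNA w h)))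
        · intro hw
          refine ⟨Or.inl hw, ?_⟩
          by_cases hwv : w = v
          · rw [hwv]
            rw [hN, mem_filter] at hcN
            exact D.adj_symm hcN.2
          · exact D.adj_symm (hfull w hw hwv c hcA)
      rw [this, hA]
  · intro z hz w
    rw [mem_union, not_or] at hz
    obtain ⟨hzA, hzN⟩ := hz
    have hzv : z ≠ v := fun h => hzA (h ▸ hvA)
    constructor
    · intro hzw
      have hwA : w ∈ A := by
        have := hsub z w hzw
        by_contra hwA
        exact hzA (this.mpr hwA)
      have hwv : w ≠ v := by
        intro hwv
        rw [hwv] at hzw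
        exact hzN (by rw [hN, mem_filter]; exact ⟨mem_univ z, D.adj_symm hzw⟩)
      exact (hmemxy w).mp (mem_erase.mpr ⟨hwv, hwA⟩)
    · rintro (rfl | rfl)
      · exact D.adj_symm (hfull w hx.2 hx.1 z hzA)
      · exact D.adj_symm (hfull w hy.2 hy.1 z hzA)

/-- **THE LINE FOR `k ≥ 10`:** a `K₄⁻`-free graph on `k ≥ 10` vertices with `2k − 3` edges attains
`Σ_v d(v)² = m k − 5 (k − 6)` iff it is a hang family graph. -/
theorem line_eq_iff_ten (D : SimpleGraph V) [DecidableRel D.Adj] (hK : K4mFree D) (hk : 10 ≤ Fintype.card V)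
    (hm : D.edgeFinset.card + 3 = 2 * Fintype.card V) :
    ∑ v, deg D v * deg D v + (Fintype.card V - 6) * 5 = D.edgeFinset.card * Fintype.card V ↔ HangFamily D := by
  constructor
  · intro heq
    rcases (line_eq_iff_explicit D hK (by omega) hm).mp heq with ⟨A, v, hA, hsub, hv⟩ | hhang
    · exact hangFamily_of_star D hk hm hA hsub hv
    · exact hhang
  · exact line_eq_of_hangFamily D hm

/-- **THE LINE FOR `k ≥ 10`, EXPLICITLY:** extremal iff a six-core on which `D` is `K_{3,3}` or the prism, a
NON-ADJACENT pair `x, y` of the core, and every other vertex adjacent exactly to `x` and `y`. -/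
theorem line_eq_iff_ten_explicit (D : SimpleGraph V) [DecidableRel D.Adj] (hK : K4mFree D)
    (hk : 10 ≤ Fintype.card V) (hm : D.edgeFinset.card + 3 = 2 * Fintype.card V) :
    ∑ v, deg D v * deg D v + (Fintype.card V - 6) * 5 = D.edgeFinset.card * Fintype.card V ↔
      ∃ (C : Finset V) (x y : V), HangOn D C x y ∧ ¬ D.Adj x y ∧ (IsK33On D C ∨ IsPrismOn D C) := by
  rw [line_eq_iff_ten D hK hk hm]
  constructor
  · rintro ⟨C, x, y, h⟩
    exact ⟨C, x, y, h, hangOn_not_adj D hK (by omega) h, cubic_six_classification D hK h.1 h.2.2.2.2.1⟩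
  · rintro ⟨C, x, y, h, -, -⟩
    exact ⟨C, x, y, h⟩

/-- **THE LINE FOR EVERY `k ≥ 7`, WITH THE CORE CLASSIFIED:** extremal iff star-shaped or a hang family graph
on a `K_{3,3}` or prism core. -/
theorem line_eq_iff_explicit' (D : SimpleGraph V) [DecidableRel D.Adj] (hK : K4mFree D)
    (hk : 7 ≤ Fintype.card V) (hm : D.edgeFinset.card + 3 = 2 * Fintype.card V) :
    ∑ v, deg D v * deg D v + (Fintype.card V - 6) * 5 = D.edgeFinset.card * Fintype.card V ↔
      (∃ (A : Finset V) (v : V), A.card = 3 ∧ BipSub D A ∧ MissingStar D A v) ∨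
        ∃ (C : Finset V) (x y : V), HangOn D C x y ∧ (IsK33On D C ∨ IsPrismOn D C) := by
  rw [line_eq_iff_explicit D hK hk hm]
  constructor
  · rintro (hstar | ⟨C, x, y, h⟩)
    · exact Or.inl hstar
    · exact Or.inr ⟨C, x, y, h, cubic_six_classification D hK h.1 h.2.2.2.2.1⟩
  · rintro (hstar | ⟨C, x, y, h, -⟩)
    · exact Or.inl hstar
    · exact Or.inr ⟨C, x, y, h⟩

end C047

end TriangleCap

end PercRepro
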